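import Mathlib
import HarnessLib

/-!
# Markman's grading `B ⊗ B = ⊕ₖ BB_k` by CM-type overlap ([S] §10): the printed DIMENSION COUNTS, kernel-checked

E. Markman, [S] *Secant sheaves and Weil classes on abelian varieties*, arXiv:2509.23403 **v2** (2026-02-11), bib
`Markman2025SurveySecant` (published carrier: ICM 2026 Proceedings, bib `Markman2026ICMSecant`, whose SIAM numbering is
NOT verified — the numbering below is the PREPRINT's). Page/line = PyMuPDF lines of the public v2 PDF (sha256/16
`3151aee3307548da`); §10 is WORD-STABLE between v1 (sha256/16 `1793579458837500`; p. 16 L30 – p. 17 L53) and v2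
(p. 16 L34 – p. 17 L62) except «In particular, dim(BB₁) = …» (v1) → «So dim(BB₁) = …» (v2) and one sentence on the
Hodge-star analogue in the sketch of proof of Lemma 10.1 (machine diff at seat lit-w-markman, pub-hsemireg LIT-W,
2026-08-23; sheet `LOCATOR-SHEET-MARKMAN.md` §39; TABLE rows M-Mk2 ∕ M-Mk7 — the printed criterion behind Condition (2c)).
The three §10 windows below were re-read BY EYE on 216-dpi renders (`HOME/lit/Markman-renders-litw-markman-g13/
r_mar25b_v2_p16_bottom_sec10.png`, `r_mar25b_v2_p17_top_sec10.png`, `r_mar25b_v2_p17_mid_sec10.png`), because the text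
layer flattens the binomial coefficient.

## What is printed (verbatim)
* SETUP, [S] §1.1, v2 p. 2 L9–13, L26–27, L33–34: «A CM-field `K` is a quadratic extension of a number field `F`, such
  that all embeddings of `F` in `ℂ` are real and none of the embeddings of `K` in `ℂ` are real. Set `e := [K : ℚ]`. Let
  `Σ` be the set of all embeddings `σ : K → ℂ`. The cardinality of `Σ` is `e`. Let `ι` be the involution in `Gal(K/F)`.
  Then `σ ∘ ι = σ̄`, for all `σ ∈ Σ`, where `σ̄` is the complex conjugate embedding. … the subspace `HW(A, η) :=
  ∧^d_K H¹(A, ℚ)` of `∧^d H¹(A, ℚ)` is an `e`-dimensional subspace … Note that both `e` and `d` are necessarily even,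
  and so `dim_ℂ(A) = 2n`, where `n := de/4` is an integer.»; footnote 2 (p. 2 L68): «Let `Σ̂` be the set of embeddings
  of `F` into `ℝ`.»
* CM-TYPES, [S] §5, v2 p. 11 L29–34: «For a general CM-field `K` we get a maximal isotropic subspace `W_T` of `V_ℂ`
  associated to each choice of a CM-type `T : Σ̂ → Σ`. We denote by `T` the two equivalent data: • a subset of `Σ`
  consisting of a choice of one embedding for each pair of two complex conjugate embeddings, and • a right inverse
  `T : Σ̂ → Σ` of the restriction map `Σ → Σ̂`.»; p. 12 L3–10: «Let `T_K` be the set of all CM-types for `K`. The linear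
  subspace `B_ℂ ⊂ S⁺_ℂ` spanned by the lines `{ℓ_{W_T}}_{T ∈ T_K}` is defined over `ℚ` and corresponds to a subspace
  (5.8) `B ⊂ S⁺_ℚ` of dimension `2^{e/2}` [M3, Lem. 7.1.3, Cor. 7.2.2]. Denote by `T̄` the CM-type complex conjugate to
  `T` given by `T̄(σ̂) = T(σ̂) ∘ ι`.»
* THE GRADING, [S] §10, v2 p. 16 L38 – p. 17 L10: «We define a natural grading `B ⊗_ℚ B = ⊕_{k=0}^{e/2} BB_k` on
  `B ⊗_ℚ B` as follows. Given two CM-types `T, T′`, set `T ∩ T′ := T(Σ̂) ∩ T′(Σ̂) ⊂ Σ` and let `|T ∩ T′|` be its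
  cardinality. The subspace `BB_{k,ℂ} := ⊕_{(T₁,T₂) ∈ T_K × T_K, |T₁ ∩ T₂| = k} ℓ_{W_{T₁}} ⊗ ℓ_{W_{T₂}}` is defined over
  `ℚ` and corresponds to a subspace `BB_k ⊂ B ⊗_ℚ B` of dimension `binom(e/2, k) · 2^{e/2}`. So `dim(BB₁) =
  e · 2^{(e/2 − 1)}`.»
* THE `e = 2` SENTENCES, [S] §10, v2 p. 17 L32–38: «We have `dim(HW(X × X̂, η)) = e`. Hence, `dim(BB₁) =
  dim(HW(X × X̂, η))` and (10.1) is an isomorphism, if and only if `e = 2`, if and only if `F = ℚ`. In that case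
  `B_ℂ = ℓ_W ⊕ ℓ_W̄` and Condition (2c) in section 4 requires that `ch(F₁) ⊗ ch(F₂)` does not belong to the
  2-dimensional subspace `BB₀ := [ℓ_W ⊗ ℓ_W̄] ⊕ [ℓ_W̄ ⊗ ℓ_W]` of the 4-dimensional `B ⊗_ℚ B`.»

## What this file proves (the finite combinatorics of those sentences; theorems only; NO named fact)
MODEL (the cell's, labelled as such): `m := e/2 = |Σ̂|` real places; `Σ` is modelled as `Fin m × Bool` with the
restriction map `Prod.fst` and `ι` flipping the `Bool` (every real place has exactly the two conjugate embeddings above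
it — the printed «quadratic extension … none of the embeddings of `K` … are real»). A CM-type in its printed second form
«a right inverse `T : Σ̂ → Σ` of the restriction map» is then the same datum as a function `T : Fin m → Bool`
(`sectionEquiv`), and the printed `T ∩ T′ := T(Σ̂) ∩ T′(Σ̂) ⊂ Σ` has cardinality the number of real places at which `T`
and `T′` agree (`card_inter`). The lines `ℓ_{W_{T₁}} ⊗ ℓ_{W_{T₂}}` are taken as a basis of `B ⊗_ℚ B` indexed by
`T_K × T_K` (printed: `dim B = 2^{e/2} = |T_K|`), so the printed «dimension of `BB_k`» is the NUMBER OF PAIRS `(T₁, T₂)`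
with `|T₁ ∩ T₂| = k`.
* `card_cmType`: `|T_K| = 2^{e/2}` — the printed `dim B` as a count of CM-types.
* `card_pairs_inter`: `#{(T₁, T₂) : |T₁ ∩ T₂| = k} = binom(m, k) · 2^m` for all `m, k` — the printed `dim BB_k`.
* `sum_card_pairs_inter` ∕ `card_pairs_total`: `∑_{k=0}^{m} binom(m, k) · 2^m = 2^m · 2^m = |T_K × T_K|` — the grading
  exhausts `B ⊗ B`.
* `card_pairs_inter_one`, `dimBB_one_printed`: `dim BB₁ = m · 2^m`, i.e. `binom(e/2, 1) · 2^{e/2} = e · 2^{e/2 − 1}` for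
  even `e > 0` — the printed «So».
* `dimBB_one_eq_e_iff`: `binom(e/2, 1) · 2^{e/2} = e ↔ e = 2` for even `e > 0` — «`dim(BB₁) = dim(HW(X × X̂, η))`
  [`= e`] … if and only if `e = 2`» AS A DIMENSION COUNT (`dim HW = e` is taken BY VALUE from §1.1).
* `card_inter_conj`, `card_inter_eq_zero_iff`: `|T ∩ T̄| = 0` and `|T ∩ T′| = 0 ↔ T′ = T̄` — `BB₀` is indexed exactly by
  the pairs `(T, T̄)`, which at `e = 2` is the printed `BB₀ := [ℓ_W ⊗ ℓ_W̄] ⊕ [ℓ_W̄ ⊗ ℓ_W]`; `cmType_one` (at `e = 2` the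
  CM-types are `T` and `T̄`: «`B_ℂ = ℓ_W ⊕ ℓ_W̄`»); `e_two_counts` (`|T_K × T_K| = 4`, `dim BB₀ = 2`, `dim BB₁ = 2`).
* `four_dvd_de`: «both `e` and `d` are … even, and so … `n := de/4` is an integer».
BY VALUE (not re-derived here): `dim B = |T_K|` (the `ℓ_{W_T}` are linearly independent, [M3, Lem. 7.1.3,
Cor. 7.2.2]), `dim HW = e` ([DM, Prop. 4.4]), the rationality of `BB_k`, Lemma 10.1, the map (10.1) and
Proposition 10.2. Nothing in this file is about an abelian variety, a sheaf or a Hodge class; nothing here says that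
HC ∕ HC_CM ∕ HC_AV is proved or that any object is semiregular or hyperholomorphic.
-/

namespace Literature.AlgebraicGeometry.Markman2025.BBGrading

open Finset

/-- A CM-type of a CM-field with `m = e/2` real places, in the printed form «a choice of one embedding for each pair
of two complex conjugate embeddings» [cite: Markman2025SurveySecant, §5 p. 11 L29–34] (MODEL: `Σ = Fin m × Bool`,
so the choice is a function `Fin m → Bool`). -/
abbrev CMType (m : ℕ) := Fin m → Bool

variable {m : ℕ}

/-- The CM-type `T` as «a right inverse `T : Σ̂ → Σ` of the restriction map `Σ → Σ̂`»
[cite: Markman2025SurveySecant, §5 p. 11 L34] (MODEL: restriction = `Prod.fst`). -/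
def emb (T : CMType m) : Fin m → Fin m × Bool := fun i => (i, T i)

/-- The complex conjugate CM-type, «`T̄(σ̂) = T(σ̂) ∘ ι`» [cite: Markman2025SurveySecant, §5 p. 12 L10]
(MODEL: `ι` flips the `Bool` coordinate of `Σ = Fin m × Bool`). -/
def conj (T : CMType m) : CMType m := fun i => !T i

/-- «Given two CM-types `T, T′`, set `T ∩ T′ := T(Σ̂) ∩ T′(Σ̂) ⊂ Σ`» [cite: Markman2025SurveySecant, §10 p. 16 L40]. -/
def inter (T T' : CMType m) : Finset (Fin m × Bool) := univ.image (emb T) ∩ univ.image (emb T')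

/-- The set of real places at which two CM-types agree (the cell's MODEL of `T ∩ T′` read inside `Σ̂`) [folklore]. -/
def agree (T T' : CMType m) : Finset (Fin m) := univ.filter fun i => T i = T' i

/-- `emb T` IS a right inverse of the restriction map `Σ → Σ̂` [cite: Markman2025SurveySecant, §5 p. 11 L34]. -/
theorem fst_comp_emb (T : CMType m) : Prod.fst ∘ emb T = id := rfl

/-- A right inverse of the restriction map is injective [cite: Markman2025SurveySecant, §5 p. 11 L34]. -/
theorem emb_injective (T : CMType m) : Function.Injective (emb T) := by
  intro i j h
  exact congrArg Prod.fst h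

/-- «We denote by `T` the two equivalent data»: right inverses of the restriction `Σ → Σ̂` are the same as choice
functions `Fin m → Bool` [cite: Markman2025SurveySecant, §5 p. 11 L30–34] (MODEL CHECK). -/
def sectionEquiv (m : ℕ) : {S : Fin m → Fin m × Bool // ∀ i, (S i).1 = i} ≃ CMType m where
  toFun S := fun i => (S.1 i).2
  invFun T := ⟨emb T, fun _ => rfl⟩
  left_inv S := by
    apply Subtype.ext
    funext i
    show ((i, (S.1 i).2) : Fin m × Bool) = S.1 i
    exact Prod.ext (S.2 i).symm rfl
  right_inv T := rfl

/-- `|T_K| = 2^{e/2}` — the printed `dim B = 2^{e/2}` [cite: Markman2025SurveySecant, §5 p. 12 L3–9], as the number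
of CM-types (MODEL: `m = e/2`). -/
theorem card_cmType (m : ℕ) : Fintype.card (CMType m) = 2 ^ m := by
  simp [CMType]

/-- MODEL CHECK: the printed `T ∩ T′ = T(Σ̂) ∩ T′(Σ̂)` [cite: Markman2025SurveySecant, §10 p. 16 L40] is the image
under `T` of the set of real places where `T` and `T′` agree. -/
theorem inter_eq_image_agree (T T' : CMType m) : inter T T' = (agree T T').image (emb T) := by
  ext ⟨i, b⟩
  simp only [inter, agree, emb, mem_inter, mem_image, mem_filter, mem_univ, true_and, Prod.mk.injEq]
  aesop

/-- «let `|T ∩ T′|` be its cardinality» [cite: Markman2025SurveySecant, §10 p. 16 L40]: it is the number of real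
places at which `T` and `T′` agree (MODEL CHECK). -/
theorem card_inter (T T' : CMType m) : (inter T T').card = (agree T T').card := by
  rw [inter_eq_image_agree, card_image_of_injective _ (emb_injective T)]

/-- For a fixed CM-type `T`, recording where `T′` agrees with `T` is a bijection `T_K ≃ 𝒫(Σ̂)` [folklore]. -/
private def agreeEquiv (T : CMType m) : CMType m ≃ Finset (Fin m) where
  toFun T' := agree T T'
  invFun S := fun i => if i ∈ S then T i else !T i
  left_inv T' := by
    funext i
    simp only [agree, mem_filter, mem_univ, true_and]
    by_cases h : T i = T' i
    · rw [if_pos h, h]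
    · rw [if_neg h]
      cases h1 : T i <;> cases h2 : T' i <;> simp_all
  right_inv S := by
    ext i
    simp only [agree, mem_filter, mem_univ, true_and]
    by_cases h : i ∈ S
    · simp [h]
    · simp [h]

/-- For a fixed CM-type `T₁`, the number of CM-types `T₂` agreeing with `T₁` at exactly `k` real places is
`binom(m, k)` [folklore]. -/
private theorem card_filter_agree (T : CMType m) (k : ℕ) :
    (univ.filter fun T' : CMType m => (agree T T').card = k).card = m.choose k := by
  rw [← Fintype.card_subtype,
    Fintype.card_congr ((agreeEquiv T).subtypeEquiv (p := fun T' : CMType m => (agree T T').card = k)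
      (q := fun S : Finset (Fin m) => S.card = k) (fun _ => Iff.rfl)),
    Fintype.card_finset_len, Fintype.card_fin]

/-- THE PRINTED DIMENSION OF `BB_k` [cite: Markman2025SurveySecant, §10 p. 16 L41 – p. 17 L9]: the number of pairs
`(T₁, T₂) ∈ T_K × T_K` with `|T₁ ∩ T₂| = k` is `binom(e/2, k) · 2^{e/2}` (MODEL: `m = e/2`; holds for every `k`, the
count being `0` for `k > m`). -/
theorem card_pairs_inter (m k : ℕ) :
    (univ.filter fun p : CMType m × CMType m => (inter p.1 p.2).card = k).card = m.choose k * 2 ^ m := by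
  simp_rw [card_inter]
  rw [card_filter, Fintype.sum_prod_type]
  simp_rw [← card_filter, card_filter_agree]
  rw [sum_const, card_univ, card_cmType, smul_eq_mul, mul_comm]

/-- `|T_K × T_K| = 2^{e/2} · 2^{e/2}` — the printed `dim (B ⊗_ℚ B)` with `dim B = 2^{e/2}`
[cite: Markman2025SurveySecant, §5 p. 12 L9]. -/
theorem card_pairs_total (m : ℕ) : Fintype.card (CMType m × CMType m) = 2 ^ m * 2 ^ m := by
  rw [Fintype.card_prod, card_cmType]

/-- «a natural grading `B ⊗_ℚ B = ⊕_{k=0}^{e/2} BB_k`» [cite: Markman2025SurveySecant, §10 p. 16 L38–39]: the printed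
dimensions add up, `∑_{k=0}^{m} binom(m, k) · 2^m = 2^m · 2^m`. -/
theorem sum_card_pairs_inter (m : ℕ) : ∑ k ∈ range (m + 1), m.choose k * 2 ^ m = 2 ^ m * 2 ^ m := by
  rw [← sum_mul, Nat.sum_range_choose]

/-- `dim BB₁ = m · 2^m` [cite: Markman2025SurveySecant, §10 p. 17 L9]. -/
theorem card_pairs_inter_one (m : ℕ) :
    (univ.filter fun p : CMType m × CMType m => (inter p.1 p.2).card = 1).card = m * 2 ^ m := by
  rw [card_pairs_inter, Nat.choose_one_right]

/-- «So `dim(BB₁) = e · 2^{(e/2 − 1)}`» [cite: Markman2025SurveySecant, §10 p. 17 L9]: for even `e > 0`,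
`binom(e/2, 1) · 2^{e/2} = e · 2^{e/2 − 1}`. -/
theorem dimBB_one_printed (e : ℕ) (he : Even e) (hpos : 0 < e) :
    (e / 2).choose 1 * 2 ^ (e / 2) = e * 2 ^ (e / 2 - 1) := by
  obtain ⟨m, rfl⟩ := he
  obtain ⟨j, rfl⟩ : ∃ j, m = j + 1 := ⟨m - 1, by omega⟩
  rw [show (j + 1 + (j + 1)) / 2 = j + 1 by omega, Nat.choose_one_right, Nat.add_sub_cancel, pow_succ]
  ring

/-- «We have `dim(HW(X × X̂, η)) = e`. Hence, `dim(BB₁) = dim(HW(X × X̂, η))` and (10.1) is an isomorphism, if and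
only if `e = 2`» [cite: Markman2025SurveySecant, §10 p. 17 L32–33] — AS A DIMENSION COUNT: for even `e > 0`,
`dim BB₁ = binom(e/2, 1) · 2^{e/2}` equals `e` if and only if `e = 2` (`dim HW = e` taken BY VALUE from §1.1, p. 2
L26–27). -/
theorem dimBB_one_eq_e_iff (e : ℕ) (he : Even e) (hpos : 0 < e) :
    (e / 2).choose 1 * 2 ^ (e / 2) = e ↔ e = 2 := by
  obtain ⟨m, rfl⟩ := he
  rw [show (m + m) / 2 = m by omega, Nat.choose_one_right]
  constructor
  · intro h
    have hm : 0 < m := by omega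
    have h2 : 2 ^ m = 2 := Nat.eq_of_mul_eq_mul_left hm (h.trans (Nat.mul_two m).symm)
    have h1 : m = 1 := Nat.pow_right_injective (le_refl 2) (h2.trans (pow_one 2).symm)
    omega
  · intro h
    obtain rfl : m = 1 := by omega
    norm_num

/-- `T̄` is again a CM-type with `T̄̄ = T` [cite: Markman2025SurveySecant, §5 p. 12 L10]. -/
theorem conj_conj (T : CMType m) : conj (conj T) = T := by
  funext i
  simp [conj]

/-- `|T ∩ T| = e/2`: the diagonal pairs lie in the top piece `BB_{e/2}` of the printed grading
[cite: Markman2025SurveySecant, §10 p. 16 L38–45]. -/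
theorem card_inter_self (T : CMType m) : (inter T T).card = m := by
  rw [card_inter, agree]
  simp

/-- `|T ∩ T̄| = 0`: the pairs `(T, T̄)` lie in `BB₀` [cite: Markman2025SurveySecant, §10 p. 17 L36–37]. -/
theorem card_inter_conj (T : CMType m) : (inter T (conj T)).card = 0 := by
  rw [card_inter, agree, card_eq_zero, filter_eq_empty_iff]
  intro i _
  simp [conj]

/-- `BB₀` is indexed EXACTLY by the pairs `(T, T̄)`: `|T ∩ T′| = 0 ↔ T′ = T̄` — at `e = 2` this is the printed
«`BB₀ := [ℓ_W ⊗ ℓ_W̄] ⊕ [ℓ_W̄ ⊗ ℓ_W]`» [cite: Markman2025SurveySecant, §10 p. 17 L36–37]. -/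
theorem card_inter_eq_zero_iff (T T' : CMType m) : (inter T T').card = 0 ↔ T' = conj T := by
  rw [card_inter, agree, card_eq_zero, filter_eq_empty_iff]
  constructor
  · intro h
    funext i
    have hi := h (mem_univ i)
    simp only [conj]
    cases h1 : T i <;> cases h2 : T' i <;> simp_all
  · rintro rfl i -
    simp [conj]

/-- At `e = 2` (`m = 1`) the CM-types are `T` and `T̄`: «In that case `B_ℂ = ℓ_W ⊕ ℓ_W̄`»
[cite: Markman2025SurveySecant, §10 p. 17 L33–34]. -/
theorem cmType_one (T T' : CMType 1) : T' = T ∨ T' = conj T := by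
  by_cases h : T' 0 = T 0
  · left
    funext i
    rw [Subsingleton.elim i 0]
    exact h
  · right
    funext i
    rw [Subsingleton.elim i 0]
    simp only [conj]
    cases h1 : T' 0 <;> cases h2 : T 0 <;> simp_all

/-- At `e = 2`: `|T_K| = 2` [cite: Markman2025SurveySecant, §10 p. 17 L33–34]. -/
theorem card_cmType_one : Fintype.card (CMType 1) = 2 := by
  rw [card_cmType, pow_one]

/-- At `e = 2`: «the 2-dimensional subspace `BB₀` … of the 4-dimensional `B ⊗_ℚ B`», and `dim BB₁ = 2 = e`
[cite: Markman2025SurveySecant, §10 p. 17 L32–38] (MODEL counts at `m = 1`). -/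
theorem e_two_counts :
    Fintype.card (CMType 1 × CMType 1) = 4 ∧
    (univ.filter fun p : CMType 1 × CMType 1 => (inter p.1 p.2).card = 0).card = 2 ∧
    (univ.filter fun p : CMType 1 × CMType 1 => (inter p.1 p.2).card = 1).card = 2 := by
  refine ⟨?_, ?_, ?_⟩
  · rw [card_pairs_total]; norm_num
  · rw [card_pairs_inter]; norm_num
  · rw [card_pairs_inter]; norm_num

/-- «both `e` and `d` are necessarily even, and so `dim_ℂ(A) = 2n`, where `n := de/4` is an integer»
[cite: Markman2025SurveySecant, §1.1 p. 2 L33–34]. -/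
theorem four_dvd_de (d e : ℕ) (hd : Even d) (he : Even e) : 4 ∣ d * e := by
  obtain ⟨a, rfl⟩ := hd
  obtain ⟨b, rfl⟩ := he
  exact ⟨a * b, by ring⟩


/-! ### Appendix B (seat lit-w-markman g14, 2026-08-23): the CHARACTER MULTIPLICITIES of the same grading and of
`⟨HW⟩` in the CM paper [C] = E. Markman, *Secant sheaves and Weil classes on abelian 2n-folds of CM-type*,
arXiv:2509.23079 **v1** (2025-09-27, only version; sha256/16 `57d91afec2bfe09f`), bib
`Markman2025SecantRealMultiplication` — UNREFEREED PREPRINT; §10.1 p. 31 L11–44, p. 33 L42–59 and §10.2 p. 33 L60 –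
p. 34 L11, AS PRINTED (page/line = PyMuPDF text-layer lines; the five quotation windows below were read BY EYE on
160-dpi renders `HOME/lit/Markman-renders-litw-markman-g14/r_mar25c_v1_p31_mid_HWdef.png`, `r_mar25c_v1_p31_L1011_mult.png`,
`r_mar25c_v1_p33_bottom_BBk.png`, `r_mar25c_v1_p34_top_HWmult.png` at seat lit-w-markman g14 — the text layer flattens
the binomial coefficients and prints the superscripts `⟨HW⟩^{kd}` inline).

WHAT IS PRINTED (all five windows also read BY EYE at a second seat on its own renders: lit-3 g39, bus l.13340, CONCUR).
p. 31 L11–21: «Note that the characters `ℓ_{T₁} ⊗ ℓ_{T₁′}` and `ℓ_{T₂} ⊗ ℓ_{T₂′}` of `Spin(V_ℚ)_η` are isomorphic, if and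
only if `T₁ ∩ T₁′ = T₂ ∩ T₂′`, by Lemma 7.2.1. Consequently, the characters … are different, if
`|T₁ ∩ T₁′| ≠ |T₂ ∩ T₂′|`.» (print places the prime after the index); p. 31 L22–27: «Denote by `⟨HW⟩` the intersection of `∧^*V_ℚ` with the subalgebra of
`∧^*(V ⊗_ℤ K̃)` generated by `HW ⊗_ℚ K̃ = ⊕_{σ∈Σ} ∧^d V_σ`. Then `⟨HW⟩` is a graded subalgebra and
`⟨HW⟩ = ⊕_{k=0}^{e} ⟨HW⟩^{kd}`, where `⟨HW⟩^{kd}` consists of the rational points of the direct sum of all wedge products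
`∧_{i=1}^{k} ∧^d V_{σ_i}`.»; p. 31 L38–44: «Note that `dim_ℚ(B) = 2^{dim_ℚ(F)} = 2^{e/2}` and so `dim_ℚ(B ⊗_ℚ B) = 2^e`.
The character `det_σ` of `Spin(V_K̃)_η` appears in `BB_k ⊗_ℚ K̃`, if and only if `k = 1` and its multiplicity in
`BB₁ ⊗_ℚ K̃` is `2^{(e/2 − 1)}`. We see that `dim_ℚ(BB₁) = e·2^{(e/2 − 1)}` and so the composition (10.1.1) is injective, if
and only if `e = 2`.»; p. 33 L42–59: «The character `det_{σ₁} ⊗ ⋯ ⊗ det_{σ_k}`, with `σ̂₁, …, σ̂_k` distinct in `Σ̂`,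
appears only in `BB_k ⊗_ℚ K̃` and it appears in `BB_k ⊗_ℚ K̃` with multiplicity `2^{(e/2 − k)}`. Denote by `BB_{T∩T′}` the
subspace of `BB_k ⊗_ℚ K̃`, `k = |T ∩ T′|`, such that `BB_{T∩T′}` is the direct sum of all characters of `Spin(V_K̃)_η`
isomorphic to `⊗_{σ̂ ∈ T∩T′} det_{T(σ̂)}`. There are `2^k binom(e/2, k)` pairwise non-isomorphic such characters, so the
dimension of `BB_k` is `binom(e/2, k) 2^{e/2}`.»; §10.2, p. 33 L60 – p. 34 L11: «The graded summand `⟨HW⟩^k` vanishes,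
if `d ∤ k`, and `dim_ℚ ⟨HW⟩^{dk} = binom(e, k)`, for `0 ≤ k ≤ e`. The multiplicity of `det_σ` in `⟨HW⟩^{dk} ⊗_ℚ K̃` is
`0`, if `k` is even, and it is `binom((e/2) − 1, i)`, if `k = 2i + 1`, for `0 ≤ i ≤ e/2 − 1`. Hence, the multiplicity of
`det_σ` in `⟨HW⟩ ⊗_ℚ K̃` is equal to its multiplicity in `B ⊗_ℚ B ⊗_ℚ K̃`.»

MODEL (the cell's, as above, `m = e/2`, `Σ = Fin m × Bool`): by the printed Lemma 7.2.1 sentence, the isomorphism class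
of the character `ℓ_T ⊗ ℓ_{T′}` IS the set `T ∩ T′ ⊂ Σ`; we encode it as the function `char T T′ : Fin m → Option Bool`
(`some b` at a real place where both choose the embedding `b`, `none` elsewhere) and check `inter T T′ =
{(i, b) : char T T′ i = some b}` (`mem_inter_iff_char`). For `⟨HW⟩`: `⟨HW⟩^{dk}` has the basis of lines
`∧_{σ∈S} ∧^d V_σ`, `S ⊂ Σ`, `|S| = k` (printed), and — BY VALUE, the torus bookkeeping the printed multiplicities use —
the character of that line is `⊗_{σ∈S} det_σ` with `det_σ̄ ≅ det_σ^{-1}` and no further relations, i.e. its class is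
`cls S := Σ_{(j,b)∈S} (±e_j) ∈ ℤ^m`; «multiplicity of `det_σ`» = the number of `S` with `cls S = cls {σ}`.
THEOREMS: `card_pairs_char_eq` (multiplicity `2^{m−k}` of each character in `BB_k`), `card_chars` (`2^k·binom(m,k)`
characters), their product (= `card_pairs_inter`), `detChar_mem_chars_iff` ∕ `card_pairs_detChar` (`det_σ` occurs among the
`BB_k`-characters iff `k = 1`, with multiplicity `2^{m−1}`), `card_subsets_sigma` (`dim ⟨HW⟩^{dk} = binom(2m, k)`),
`card_HW_detMultiplicity` (`0` for even `k`, `binom(m−1, i)` for `k = 2i+1`), `sum_HW_detMultiplicity`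
(`Σ_i binom(m−1, i) = 2^{m−1}` = the `BB` multiplicity: «Hence … equal»). Nothing here is about a variety. -/

section Characters

/-- The character of the pair `(T, T′)` in the MODEL: at the real place `i`, `some (T i)` if `T` and `T′` choose the
same embedding there, `none` otherwise — by [C] p. 31 L11–16 («isomorphic, if and only if `T₁ ∩ T′₁ = T₂ ∩ T′₂`, by
Lemma 7.2.1») this datum IS the isomorphism class of `ℓ_T ⊗ ℓ_{T′}`.
[cite: Markman2025SecantRealMultiplication, §10.1 p. 31 L11–16] -/
def char (T T' : CMType m) : Fin m → Option Bool := fun i => if T i = T' i then some (T i) else none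

/-- MODEL CHECK: the printed `T ∩ T′ ⊂ Σ` is read off the character: `(i, b) ∈ T ∩ T′ ↔ char T T′ i = some b`.
[cite: Markman2025SecantRealMultiplication, §10.1 p. 31 L11–16] -/
theorem mem_inter_iff_char (T T' : CMType m) (i : Fin m) (b : Bool) :
    (i, b) ∈ inter T T' ↔ char T T' i = some b := by
  simp only [inter, emb, char, mem_inter, mem_image, mem_univ, true_and, Prod.mk.injEq]
  constructor
  · rintro ⟨⟨j, rfl, hj⟩, ⟨j', hj'1, hj'2⟩⟩
    subst hj'1
    rw [if_pos (hj.trans hj'2.symm)]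
    exact congrArg some hj
  · intro h
    by_cases hTT : T i = T' i
    · rw [if_pos hTT] at h
      have hb : T i = b := Option.some.inj h
      exact ⟨⟨i, rfl, hb⟩, ⟨i, rfl, hTT ▸ hb⟩⟩
    · rw [if_neg hTT] at h
      exact absurd h (by simp)

/-- Two pairs have the same character iff they have the same agreement set AND choose the same embeddings on it —
the MODEL form of «isomorphic, if and only if `T₁ ∩ T′₁ = T₂ ∩ T′₂`». [cite: Markman2025SecantRealMultiplication, §10.1
p. 31 L11–16] -/
theorem char_eq_char_iff (T₁ T₁' T₂ T₂' : CMType m) :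
    char T₁ T₁' = char T₂ T₂' ↔ ∀ i, (T₁ i = T₁' i ↔ T₂ i = T₂' i) ∧ (T₁ i = T₁' i → T₂ i = T₂' i → T₁ i = T₂ i) := by
  constructor
  · intro h i
    have hi := congrFun h i
    unfold char at hi
    constructor
    · constructor
      · intro h1
        rw [if_pos h1] at hi
        by_contra h2
        rw [if_neg h2] at hi
        exact absurd hi (by simp)
      · intro h2
        rw [if_pos h2] at hi
        by_contra h1
        rw [if_neg h1] at hi
        exact absurd hi (by simp)
    · intro h1 h2
      rw [if_pos h1, if_pos h2] at hi
      exact Option.some.inj hi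
  · intro h
    funext i
    obtain ⟨h1, h2⟩ := h i
    unfold char
    by_cases hc : T₁ i = T₁' i
    · rw [if_pos hc, if_pos (h1.mp hc), h2 hc (h1.mp hc)]
    · rw [if_neg hc, if_neg (fun h' => hc (h1.mpr h'))]


/-- The second member of a pair is determined by the first member and the character's support: `T′ i = T i` on the
agreement set and `T′ i = ¬ T i` off it. [folklore] -/
private theorem snd_eq_of_agree (T T' : CMType m) (i : Fin m) : T' i = (if T i = T' i then T i else !T i) := by
  by_cases h : T i = T' i
  · rw [if_pos h, h]
  · rw [if_neg h]
    cases h1 : T i <;> cases h2 : T' i <;> simp_all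

/-- The pairs with a prescribed character `χ = char T₀ T₀′` are in bijection with the CM-types `T` that agree with `T₀`
on the support of `χ` (the second member being forced). [folklore] -/
private def fibreEquiv (T₀ T₀' : CMType m) :
    {p : CMType m × CMType m // char p.1 p.2 = char T₀ T₀'} ≃
      {T : CMType m // ∀ i, T₀ i = T₀' i → T i = T₀ i} where
  toFun p := ⟨p.1.1, fun i hi => by
    have h := (char_eq_char_iff p.1.1 p.1.2 T₀ T₀').mp p.2 i
    exact h.2 (h.1.mpr hi) hi⟩
  invFun T := ⟨(T.1, fun i => if T₀ i = T₀' i then T.1 i else !T.1 i), by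
    apply (char_eq_char_iff _ _ _ _).mpr
    intro i
    dsimp only
    by_cases hi : T₀ i = T₀' i
    · rw [if_pos hi]
      exact ⟨⟨fun _ => hi, fun _ => rfl⟩, fun _ _ => T.2 i hi⟩
    · rw [if_neg hi]
      refine ⟨⟨fun h => ?_, fun h => absurd h hi⟩, fun _ h => absurd h hi⟩
      cases h1 : T.1 i <;> simp_all⟩
  left_inv p := by
    obtain ⟨⟨T, T'⟩, hp⟩ := p
    apply Subtype.ext
    simp only [Prod.mk.injEq, true_and]
    funext i
    have h := (char_eq_char_iff T T' T₀ T₀').mp hp i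
    rw [snd_eq_of_agree T T' i]
    by_cases hi : T₀ i = T₀' i
    · rw [if_pos hi, if_pos (h.1.mpr hi)]
    · rw [if_neg hi, if_neg (fun h' => hi (h.1.mp h'))]
  right_inv T := by
    apply Subtype.ext
    rfl

/-- CM-types agreeing with `T₀` on a set `A` of real places are in bijection with functions on the complement.
[folklore] -/
private def agreeOnEquiv (T₀ : CMType m) (A : Finset (Fin m)) :
    {T : CMType m // ∀ i ∈ A, T i = T₀ i} ≃ ({i : Fin m // i ∉ A} → Bool) where
  toFun T := fun i => T.1 i.1
  invFun f := ⟨fun i => if h : i ∈ A then T₀ i else f ⟨i, h⟩, fun i hi => by simp [hi]⟩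
  left_inv T := by
    apply Subtype.ext
    funext i
    by_cases h : i ∈ A
    · simp [h, T.2 i h]
    · simp [h]
  right_inv f := by
    funext i
    simp [i.2]

/-- **[C] p. 33 L42–44: «The character `det_{σ₁} ⊗ ⋯ ⊗ det_{σ_k}` … appears in `BB_k ⊗_ℚ K̃` with multiplicity
`2^{(e/2 − k)}`».** MODEL: the number of pairs `(T, T′) ∈ T_K × T_K` with a prescribed character — prescribed as the
character of some pair `(T₀, T₀′)` with `|T₀ ∩ T₀′| = k` — is `2^{m − k}` (`m = e/2`).
[cite: Markman2025SecantRealMultiplication, §10.1 p. 33 L42–44] -/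
theorem card_pairs_char_eq (T₀ T₀' : CMType m) :
    (univ.filter fun p : CMType m × CMType m => char p.1 p.2 = char T₀ T₀').card =
      2 ^ (m - (inter T₀ T₀').card) := by
  rw [card_inter, ← Fintype.card_subtype, Fintype.card_congr (fibreEquiv T₀ T₀')]
  have hA : ∀ T : CMType m, (∀ i, T₀ i = T₀' i → T i = T₀ i) ↔ (∀ i ∈ agree T₀ T₀', T i = T₀ i) := by
    intro T
    simp [agree]
  rw [Fintype.card_congr (Equiv.subtypeEquivRight hA), Fintype.card_congr (agreeOnEquiv T₀ (agree T₀ T₀')),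
    Fintype.card_fun, Fintype.card_bool, Fintype.card_subtype_compl, Fintype.card_fin]
  congr 1
  rw [Fintype.card_coe]


/-- Pairs with the same character have the same `|T ∩ T′|` (the printed «Consequently, the characters … are different,
if `|T₁ ∩ T′₁| ≠ |T₂ ∩ T′₂|`», p. 31 L16–21). [cite: Markman2025SecantRealMultiplication, §10.1 p. 31 L16–21] -/
theorem card_inter_eq_of_char_eq {T₁ T₁' T₂ T₂' : CMType m} (h : char T₁ T₁' = char T₂ T₂') :
    (inter T₁ T₁').card = (inter T₂ T₂').card := by
  rw [card_inter, card_inter]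
  congr 1
  ext i
  simp only [agree, mem_filter, mem_univ, true_and]
  exact ((char_eq_char_iff _ _ _ _).mp h i).1

/-- The characters occurring in `BB_k` (MODEL): the image under `char` of the pairs with `|T ∩ T′| = k` — by the
printed sentence these are the characters `⊗_{σ̂ ∈ T∩T′} det_{T(σ̂)}`, `|T ∩ T′| = k`.
[cite: Markman2025SecantRealMultiplication, §10.1 p. 33 L47–54] -/
def chars (m k : ℕ) : Finset (Fin m → Option Bool) :=
  (univ.filter fun p : CMType m × CMType m => (inter p.1 p.2).card = k).image fun p => char p.1 p.2

/-- **[C] p. 33 L54–59: «There are `2^k binom(e/2, k)` pairwise non-isomorphic such characters, so the dimension of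
`BB_k` is `binom(e/2, k) 2^{e/2}`.»** MODEL count of the distinct characters in `BB_k` (`m = e/2`, `k ≤ m`), obtained
as print obtains the dimension: number of characters × the common multiplicity `2^{m−k}` = number of pairs
`binom(m, k)·2^m` (`card_pairs_inter`). [cite: Markman2025SecantRealMultiplication, §10.1 p. 33 L42–59] -/
theorem card_chars (m k : ℕ) (hk : k ≤ m) : (chars m k).card = 2 ^ k * m.choose k := by
  set P := (univ.filter fun p : CMType m × CMType m => (inter p.1 p.2).card = k) with hP
  have hsum := card_eq_sum_card_image (fun p : CMType m × CMType m => char p.1 p.2) P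
  have hfib : ∀ χ ∈ chars m k, (P.filter fun p => char p.1 p.2 = χ).card = 2 ^ (m - k) := by
    intro χ hχ
    obtain ⟨⟨T₀, T₀'⟩, hp, rfl⟩ := mem_image.mp hχ
    have hk0 : (inter T₀ T₀').card = k := (mem_filter.mp hp).2
    have hset : (P.filter fun p => char p.1 p.2 = char T₀ T₀') =
        univ.filter (fun p : CMType m × CMType m => char p.1 p.2 = char T₀ T₀') := by
      ext p
      simp only [hP, mem_filter, mem_univ, true_and]
      constructor
      · exact fun h => h.2
      · exact fun h => ⟨(card_inter_eq_of_char_eq h).trans hk0, h⟩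
    rw [hset, card_pairs_char_eq, hk0]
  have hchars : P.image (fun p : CMType m × CMType m => char p.1 p.2) = chars m k := rfl
  rw [hchars, sum_congr rfl hfib, sum_const, smul_eq_mul, hP, card_pairs_inter] at hsum
  have h2 : 2 ^ m = 2 ^ k * 2 ^ (m - k) := by rw [← pow_add, Nat.add_sub_cancel' hk]
  have hpos : 0 < 2 ^ (m - k) := by positivity
  apply Nat.eq_of_mul_eq_mul_right hpos
  rw [h2] at hsum
  linarith [hsum]

/-- The printed product: (number of characters) × (multiplicity) = `dim BB_k`, i.e.
`2^k binom(m,k) · 2^{m−k} = binom(m,k) 2^m` (`k ≤ m`). [cite: Markman2025SecantRealMultiplication, §10.1 p. 33 L42–59] -/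
theorem chars_mul_multiplicity (m k : ℕ) (hk : k ≤ m) : 2 ^ k * m.choose k * 2 ^ (m - k) = m.choose k * 2 ^ m := by
  rw [mul_comm (2 ^ k), mul_assoc, ← pow_add, Nat.add_sub_cancel' hk]

/-- The character `det_σ`, `σ = (j, b) ∈ Σ`, in the MODEL encoding (support `{j}`, value `b`).
[cite: Markman2025SecantRealMultiplication, §10.1 p. 31 L38–42] -/
def detChar (j : Fin m) (b : Bool) : Fin m → Option Bool := fun i => if i = j then some b else none

/-- `det_σ` IS the character of a pair with `|T ∩ T′| = 1`: e.g. `T ≡ b` and `T′ = b` at `j`, `¬b` elsewhere.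
[cite: Markman2025SecantRealMultiplication, §10.1 p. 31 L38–42] -/
theorem char_const_eq_detChar (j : Fin m) (b : Bool) :
    char (fun _ => b) (fun i => if i = j then b else !b) = detChar j b := by
  funext i
  unfold char detChar
  by_cases h : i = j
  · simp [h]
  · simp [h]

/-- … and that pair has `|T ∩ T′| = 1`. [cite: Markman2025SecantRealMultiplication, §10.1 p. 31 L38–42] -/
theorem card_inter_const (j : Fin m) (b : Bool) :
    (inter (fun _ => b) (fun i => if i = j then b else !b)).card = 1 := by
  rw [card_inter, agree]
  have : (univ.filter fun i : Fin m => b = if i = j then b else !b) = {j} := by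
    ext i
    simp only [mem_filter, mem_univ, true_and, mem_singleton]
    by_cases h : i = j
    · simp [h]
    · simp only [h, if_false, iff_false]
      cases b <;> simp
  rw [this, card_singleton]

/-- **[C] p. 31 L38–40: «The character `det_σ` of `Spin(V_K̃)_η` appears in `BB_k ⊗_ℚ K̃`, if and only if `k = 1`».**
MODEL: `det_σ ∈ chars m k ↔ k = 1`. [cite: Markman2025SecantRealMultiplication, §10.1 p. 31 L38–40] -/
theorem detChar_mem_chars_iff (j : Fin m) (b : Bool) (k : ℕ) : detChar j b ∈ chars m k ↔ k = 1 := by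
  constructor
  · intro h
    obtain ⟨⟨T, T'⟩, hp, hc⟩ := mem_image.mp h
    have hk : (inter T T').card = k := (mem_filter.mp hp).2
    rw [← hk, ← card_inter_const j b]
    exact card_inter_eq_of_char_eq (hc.trans (char_const_eq_detChar j b).symm)
  · rintro rfl
    exact mem_image.mpr ⟨⟨fun _ => b, fun i => if i = j then b else !b⟩,
      mem_filter.mpr ⟨mem_univ _, card_inter_const j b⟩, char_const_eq_detChar j b⟩

/-- **[C] p. 31 L40–42: «and its multiplicity in `BB₁ ⊗_ℚ K̃` is `2^{(e/2 − 1)}`».** MODEL: the number of pairs with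
character `det_σ` is `2^{m − 1}`. [cite: Markman2025SecantRealMultiplication, §10.1 p. 31 L38–42] -/
theorem card_pairs_detChar (j : Fin m) (b : Bool) :
    (univ.filter fun p : CMType m × CMType m => char p.1 p.2 = detChar j b).card = 2 ^ (m - 1) := by
  rw [← char_const_eq_detChar, card_pairs_char_eq, card_inter_const]

/-- **[C] p. 31 L42–44: «We see that `dim_ℚ(BB₁) = e2^{(e/2 − 1)}`»** as (number of characters `det_σ`, `σ ∈ Σ`,
`|Σ| = e = 2m`) × (multiplicity `2^{m−1}`) = `m · 2^m` (`= card_pairs_inter_one`; `m ≥ 1`).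
[cite: Markman2025SecantRealMultiplication, §10.1 p. 31 L42–44] -/
theorem dimBB_one_as_characters (m : ℕ) (hm : 1 ≤ m) : 2 * m * 2 ^ (m - 1) = m * 2 ^ m := by
  obtain ⟨j, rfl⟩ : ∃ j, m = j + 1 := ⟨m - 1, by omega⟩
  rw [Nat.add_sub_cancel, pow_succ]
  ring


end Characters

section HW

/-- **[C] §10.2 p. 33 L60 – p. 34 L3: «`dim_ℚ ⟨HW⟩^{dk} = binom(e, k)`, for `0 ≤ k ≤ e`»** — MODEL: `⟨HW⟩^{dk}` has the
printed basis of lines `∧_{σ∈S} ∧^d V_σ` indexed by the `k`-subsets `S ⊂ Σ` (p. 31 L24–27), `|Σ| = e = 2m`, and there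
are `binom(2m, k)` of them. [cite: Markman2025SecantRealMultiplication, §10.2 p. 33 L60 – p. 34 L3] -/
theorem card_subsets_sigma (m k : ℕ) :
    ((univ : Finset (Fin m × Bool)).powersetCard k).card = (2 * m).choose k := by
  rw [card_powersetCard, card_univ, Fintype.card_prod, Fintype.card_fin, Fintype.card_bool, mul_comm]

/-- MODEL (BY VALUE — the torus bookkeeping behind the printed multiplicities, not re-derived): the class of the character
`⊗_{σ∈S} det_σ` of the line `∧_{σ∈S} ∧^d V_σ`, written additively in `ℤ^{Σ̂}` with `det_{σ̄} = det_σ^{-1}`: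
`cls S (j) = [ (j, +) ∈ S ] − [ (j, −) ∈ S ]`. [cite: Markman2025SecantRealMultiplication, §10.2 p. 34 L3–11] -/
def cls (S : Finset (Fin m × Bool)) : Fin m → ℤ :=
  fun j => (if (j, true) ∈ S then 1 else 0) - (if (j, false) ∈ S then 1 else 0)

/-- The `k`-subsets of `Σ` whose character is `det_σ`: `σ` together with BOTH embeddings over each place of a set `U`
of real places other than `σ̂` (so `k = 2|U| + 1`) — the MODEL of the sets counted in the printed multiplicity of
`det_σ` in `⟨HW⟩^{dk}`. [cite: Markman2025SecantRealMultiplication, §10.2 p. 34 L3–9] -/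
def hwWith (σ : Fin m × Bool) (U : Finset (Fin m)) : Finset (Fin m × Bool) := insert σ (U ×ˢ univ)

/-- Membership in `hwWith σ U`. [folklore] -/
private theorem mem_hwWith (σ : Fin m × Bool) (U : Finset (Fin m)) (j : Fin m) (c : Bool) :
    (j, c) ∈ hwWith σ U ↔ (j = σ.1 ∧ c = σ.2) ∨ j ∈ U := by
  obtain ⟨j₀, b₀⟩ := σ
  simp only [hwWith, mem_insert, mem_product, mem_univ, and_true, Prod.mk.injEq]

/-- `|hwWith σ U| = 2|U| + 1` (for `σ̂ ∉ U`). [folklore] -/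
private theorem card_hwWith {σ : Fin m × Bool} {U : Finset (Fin m)} (hU : σ.1 ∉ U) :
    (hwWith σ U).card = 2 * U.card + 1 := by
  obtain ⟨j₀, b₀⟩ := σ
  have hnot : (j₀, b₀) ∉ U ×ˢ (univ : Finset Bool) := by
    simp only [mem_product, mem_univ, and_true]
    exact hU
  rw [hwWith, card_insert_of_notMem hnot, card_product, card_univ, Fintype.card_bool]
  ring

/-- The class of `hwWith σ U` is `det_σ`. [folklore] -/
private theorem cls_hwWith {σ : Fin m × Bool} {U : Finset (Fin m)} (hU : σ.1 ∉ U) : cls (hwWith σ U) = cls {σ} := by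
  obtain ⟨j₀, b₀⟩ := σ
  funext j
  have h1 : ((j, true) ∈ hwWith (j₀, b₀) U) ↔ (j = j₀ ∧ true = b₀) ∨ j ∈ U := mem_hwWith _ _ j true
  have h2 : ((j, false) ∈ hwWith (j₀, b₀) U) ↔ (j = j₀ ∧ false = b₀) ∨ j ∈ U := mem_hwWith _ _ j false
  simp only [cls, mem_singleton, Prod.mk.injEq, h1, h2]
  by_cases hj : j = j₀
  · subst hj
    have hjU : j ∉ U := hU
    cases b₀ <;> simp [hjU]
  · cases b₀ <;> by_cases hjU : j ∈ U <;> simp [hj, hjU]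

/-- STRUCTURE: a subset `S ⊂ Σ` has character `det_σ` iff `S = hwWith σ U` for a (unique) `U ⊆ Σ̂ ∖ {σ̂}` — it contains
`σ`, omits `σ̄`, and over every other real place contains both embeddings or neither.
[cite: Markman2025SecantRealMultiplication, §10.2 p. 34 L3–11] -/
theorem cls_eq_cls_single_iff (S : Finset (Fin m × Bool)) (σ : Fin m × Bool) :
    cls S = cls {σ} ↔ ∃ U : Finset (Fin m), σ.1 ∉ U ∧ S = hwWith σ U := by
  obtain ⟨j₀, b₀⟩ := σ
  constructor
  · intro h
    refine ⟨(univ.erase j₀).filter fun j => (j, true) ∈ S, by simp, ?_⟩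
    have hj0 := congrFun h j₀
    have hval : ∀ j, j ≠ j₀ → ((j, true) ∈ S ↔ (j, false) ∈ S) := by
      intro j hj
      have hj' := congrFun h j
      simp only [cls, mem_singleton, Prod.mk.injEq, hj, false_and, if_false, sub_zero] at hj'
      by_cases h1 : (j, true) ∈ S <;> by_cases h2 : (j, false) ∈ S <;> simp_all
    simp only [cls, mem_singleton, Prod.mk.injEq, true_and] at hj0
    have hσ : (j₀, b₀) ∈ S ∧ (j₀, !b₀) ∉ S := by
      cases b₀ <;>
      · by_cases h1 : (j₀, true) ∈ S <;> by_cases h2 : (j₀, false) ∈ S <;> simp_all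
    ext ⟨j, c⟩
    rw [mem_hwWith]
    simp only [mem_filter, mem_erase, mem_univ]
    by_cases hj : j = j₀
    · subst hj
      simp only [true_and, ne_eq, not_true_eq_false, false_and, or_false]
      constructor
      · intro hc
        by_contra hne
        have : c = !b₀ := by cases c <;> cases b₀ <;> simp_all
        exact hσ.2 (this ▸ hc)
      · rintro rfl
        exact hσ.1
    · simp only [hj, false_and, false_or, ne_eq, not_false_eq_true, true_and]
      cases c
      · exact (hval j hj).symm
      · exact Iff.rfl
  · rintro ⟨U, hU, rfl⟩
    exact cls_hwWith hU

/-- `hwWith σ` is injective on the sets of places avoiding `σ̂`. [folklore] -/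
private theorem hwWith_injOn (σ : Fin m × Bool) :
    Set.InjOn (hwWith σ) {U : Finset (Fin m) | σ.1 ∉ U} := by
  intro U₁ h₁ U₂ h₂ h
  ext j
  by_cases hj : j = σ.1
  · subst hj
    simp only [Set.mem_setOf_eq] at h₁ h₂
    simp [h₁, h₂]
  · have h' := congrArg (fun S => (j, !σ.2) ∈ S) h
    simp only [mem_hwWith, hj, false_and, false_or] at h'
    exact Iff.of_eq h'

/-- **[C] §10.2 p. 34 L3–9: «The multiplicity of `det_σ` in `⟨HW⟩^{dk} ⊗_ℚ K̃` is `0`, if `k` is even, and it is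
`binom((e/2) − 1, i)`, if `k = 2i + 1`, for `0 ≤ i ≤ e/2 − 1`.»** MODEL: the number of `k`-subsets `S ⊂ Σ` with
`cls S = cls {σ}` (`m = e/2`). [cite: Markman2025SecantRealMultiplication, §10.2 p. 34 L3–9] -/
theorem card_HW_detMultiplicity (σ : Fin m × Bool) (k : ℕ) :
    ((univ.powersetCard k).filter fun S : Finset (Fin m × Bool) => cls S = cls {σ}).card =
      if k % 2 = 1 then (m - 1).choose (k / 2) else 0 := by
  have hset : ((univ.powersetCard k).filter fun S : Finset (Fin m × Bool) => cls S = cls {σ}) =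
      (((univ.erase σ.1).powerset).filter fun U => 2 * U.card + 1 = k).image (hwWith σ) := by
    ext S
    simp only [mem_filter, mem_powersetCard, subset_univ, true_and, mem_image, mem_powerset]
    constructor
    · rintro ⟨hk, hcls⟩
      obtain ⟨U, hU, rfl⟩ := (cls_eq_cls_single_iff _ σ).mp hcls
      refine ⟨U, ⟨fun j hj => mem_erase.mpr ⟨fun h => hU (h ▸ hj), mem_univ _⟩, ?_⟩, rfl⟩
      rw [← hk, card_hwWith hU]
    · rintro ⟨U, ⟨hUsub, hk⟩, rfl⟩
      have hU : σ.1 ∉ U := fun h => (mem_erase.mp (hUsub h)).1 rfl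
      exact ⟨by rw [card_hwWith hU, hk], cls_hwWith hU⟩
  rw [hset, card_image_of_injOn (fun U₁ h₁ U₂ h₂ h => hwWith_injOn σ ?_ ?_ h)]
  rotate_left
  · exact fun h' => (mem_erase.mp (mem_powerset.mp (mem_filter.mp (mem_coe.mp h₁)).1 h')).1 rfl
  · exact fun h' => (mem_erase.mp (mem_powerset.mp (mem_filter.mp (mem_coe.mp h₂)).1 h')).1 rfl
  split_ifs with hodd
  · have : ((univ.erase σ.1).powerset.filter fun U : Finset (Fin m) => 2 * U.card + 1 = k) =
        (univ.erase σ.1).powersetCard (k / 2) := by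
      ext U
      simp only [mem_filter, mem_powerset, mem_powersetCard, and_congr_right_iff]
      intro _
      omega
    rw [this, card_powersetCard, card_erase_of_mem (mem_univ _), card_univ, Fintype.card_fin]
  · rw [card_eq_zero, filter_eq_empty_iff]
    intro U _
    omega

/-- **[C] §10.2 p. 34 L9–11: «Hence, the multiplicity of `det_σ` in `⟨HW⟩ ⊗_ℚ K̃` is equal to its multiplicity in
`B ⊗_ℚ B ⊗_ℚ K̃`.»** — the arithmetic: summing the odd-`k` multiplicities, `Σ_{i=0}^{m−1} binom(m − 1, i) = 2^{m−1}`,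
which is the printed multiplicity `2^{(e/2 − 1)}` of `det_σ` in `BB₁` (`card_pairs_detChar`), `det_σ` occurring in no
other `BB_k` (`detChar_mem_chars_iff`); `m ≥ 1`. [cite: Markman2025SecantRealMultiplication, §10.2 p. 34 L3–11] -/
theorem sum_HW_detMultiplicity (m : ℕ) (hm : 1 ≤ m) :
    ∑ i ∈ range m, (m - 1).choose i = 2 ^ (m - 1) := by
  obtain ⟨j, rfl⟩ : ∃ j, m = j + 1 := ⟨m - 1, by omega⟩
  rw [Nat.add_sub_cancel, Nat.sum_range_choose]

end HW

end Literature.AlgebraicGeometry.Markman2025.BBGrading
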